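import Literature.Geometry.ComplexHyperbolic.UnitBallRegularConjugationFlag   -- ★ p843835 (β-0): `mat_conj_diagonal_eq_sum` (spectral form), column facts, `diagonal_circle_preserves`
import HarnessLib

/-!
# The ONE-LEVEL support bound for regular orbital integrals of `U(2,1)` in the D regime: `(‖g₂₂‖² − 1)·min(|z₂−z₀|, |z₂−z₁|) ≤ √2·|(g·diag z·g⁻¹)₂₂ − z₂|`
# (ROAD A; the D∕S chamber dichotomy of the owner's census `CENSUS-beta-TwoScaleRegularOrbital` §3 and F0P3a-p02 (g13)'s census (ζ3) §2, made a lemma; Rogawski 1990 §8.4; Goldman 1999 §3.1.1)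

Topic `Geometry/ComplexHyperbolic`; namespace `Literature.Geometry.ComplexHyperbolic.BallModel`.  THEOREMS ONLY (no `def`, no instance, no notation, no axiom, no named fact, no `sorry`).
Cell `pub/hodgecm-mathlib`, ENGINE T1 (crux H413 = `stmt-HodgeConjecture-24833`); ROAD A (N1 = `stub_L21` ∕ `stub_ArchCentralLimitU21`); the lemma every ONE-LEVEL analysis near the centre uses (road (β)∕(E) on
D-sub-cones, the c-horn crude bounds of architecture (III), R-14.3); author F0P3a-p05 (g14) (ROAD A owner), 2026-09-01.

THE MATHEMATICS.  For `g ∈ G = U(2,1)` (`J = diag(1,1,−1)`) and `t = diag(z₀,z₁,z₂)` the spectral form ★ `mat_conj_diagonal_eq_sum` and the row identity `|g₂₀|² + |g₂₁|² = |g₂₂|² − 1` give the EXACT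
formula for the corner entry of the conjugate
  **`(g·t·g⁻¹)₂₂ = z₂ + (z₂ − z₀)|g₂₀|² + (z₂ − z₁)|g₂₁|²`**  (§1),
a combination of the two root differences through the NEGATIVE line with NON-NEGATIVE weights.  Hence (§2), whenever the two differences lie in a common closed half-plane,
`Re((z₂−z₀)·conj(z₂−z₁)) ≥ 0`:
  **`(|g₂₂|² − 1) · min(|z₂−z₀|, |z₂−z₁|) ≤ √2 · |(g·t·g⁻¹)₂₂ − z₂|`**,
so a bound `|(g·t·g⁻¹)₂₂ − z₂| ≤ R` on the support of the test function (★ `exists_radius_apply_add_eq_zero` pattern) confines `g` to `|g₂₂|² ≤ 1 + √2R∕m`, `m = min(|z₂−z₀|,|z₂−z₁|)`, i.e. the base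
point `g • x₀` to the sub-ball `1 − |g•x₀|² ≥ (1 + √2R∕m)⁻¹` (§3, ★ `one_sub_nsq_smul_x₀`) — UNIFORMLY over the `ℙ¹` fibre: ONE LEVEL.  §4 identifies the regime on the torus: for `z_p = ζe^{iθ_p}`,
`Re((z₂−z₀)conj(z₂−z₁)) = (1 − cos(θ₂−θ₁))(1 − cos(θ₀−θ₂)) − sin(θ₂−θ₁)·sin(θ₀−θ₂)`, which is `≥ 0` as soon as `(θ₂−θ₁)·(θ₀−θ₂) ≤ 0` with `|θ₂−θ₁|, |θ₀−θ₂| ≤ π` — i.e. exactly on the closed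
D-REGION «`θ₂` extremal» (the four chambers adjacent to the compact wall `θ₀ = θ₁`, walls included).  In the two S chambers (`θ₂` strictly between `θ₀, θ₁`) the weights can cancel and no such bound
holds (two-level regime) — this file says nothing there.
HONEST LABEL: HC_CM is proved only modulo the printed citations until rung 0 closes; elementary inequalities over ★ (β-0), pays nothing by itself.

## References
* [Rogawski1990] J. D. Rogawski, *Automorphic Representations of Unitary Groups in Three Variables*, Ann. of Math. Stud. 123 (1990), §8.4 pp. 126–127.
* [Goldman1999] W. M. Goldman, *Complex Hyperbolic Geometry* (1999), §3.1.1 (negative∕positive vectors, `|g₂₂|² = cosh² r`).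
* [Rudin1980] W. Rudin, *Function Theory in the Unit Ball of ℂⁿ* (1980), Thm. 2.2.2 (`1 − |g•0|² = |g₂₂|⁻²`).
-/

set_option autoImplicit false

noncomputable section

open Matrix Complex ComplexConjugate MulAction

namespace Literature.Geometry.ComplexHyperbolic

namespace BallModel

/-! ## §1 The corner entry of the conjugate -/

section Entry

/-- **THE CORNER ENTRY, spectral form**: `(g·diag z·g⁻¹)₂₂ = −(z₀|g₂₀|² + z₁|g₂₁|² − z₂|g₂₂|²)` (★ `mat_conj_diagonal_eq_sum`, `N(c)₂₂ = −|c₂|²`). [cite: Goldman1999, §3.1.1] -/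
theorem mat_conj_diagonal_apply_two_two_eq_sum (g : U21) (z : Fin 3 → Circle)
    (hz : (Matrix.diagonal fun i => (z i : ℂ))ᴴ * J * Matrix.diagonal (fun i => (z i : ℂ)) = J) :
    mat (g * mkU21 (Matrix.diagonal fun i => (z i : ℂ)) hz * g⁻¹) 2 2 =
      -((z 0 : ℂ) * (‖mat g 2 0‖ ^ 2 : ℝ) + (z 1 : ℂ) * (‖mat g 2 1‖ ^ 2 : ℝ) - (z 2 : ℂ) * (‖mat g 2 2‖ ^ 2 : ℝ)) := by
  rw [mat_conj_diagonal_eq_sum, Matrix.sum_apply, Fin.sum_univ_three]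
  simp only [Matrix.smul_apply, smul_eq_mul, vecMulVec_star_mul_J_apply, J_apply_00, J_apply_11, J_apply_22, Complex.mul_conj']
  push_cast
  ring

/-- **THE CORNER ENTRY through the negative line**: `(g·diag z·g⁻¹)₂₂ = z₂ + (z₂ − z₀)|g₂₀|² + (z₂ − z₁)|g₂₁|²` (row identity `|g₂₀|² + |g₂₁|² − |g₂₂|² = −1`, ★ `row_identity`).
[cite: Goldman1999, §3.1.1] [cite: Rogawski1990, §8.4 pp. 126–127] -/
theorem mat_conj_diagonal_apply_two_two_eq (g : U21) (z : Fin 3 → Circle)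
    (hz : (Matrix.diagonal fun i => (z i : ℂ))ᴴ * J * Matrix.diagonal (fun i => (z i : ℂ)) = J) :
    mat (g * mkU21 (Matrix.diagonal fun i => (z i : ℂ)) hz * g⁻¹) 2 2 =
      (z 2 : ℂ) + ((z 2 : ℂ) - z 0) * (‖mat g 2 0‖ ^ 2 : ℝ) + ((z 2 : ℂ) - z 1) * (‖mat g 2 1‖ ^ 2 : ℝ) := by
  have hrow : ‖mat g 2 0‖ ^ 2 + ‖mat g 2 1‖ ^ 2 - ‖mat g 2 2‖ ^ 2 = -1 := by simpa using row_identity g 2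
  have hrowC : ((‖mat g 2 2‖ ^ 2 : ℝ) : ℂ) = (‖mat g 2 0‖ ^ 2 : ℝ) + (‖mat g 2 1‖ ^ 2 : ℝ) + 1 := by
    have h : ‖mat g 2 2‖ ^ 2 = ‖mat g 2 0‖ ^ 2 + ‖mat g 2 1‖ ^ 2 + 1 := by linarith
    exact_mod_cast h
  rw [mat_conj_diagonal_apply_two_two_eq_sum, hrowC]
  ring

/-- `|g₂₀|² + |g₂₁|² = |g₂₂|² − 1` (★ `row_identity`, rearranged). [cite: Goldman1999, §3.1.1] -/
theorem norm_sq_two_zero_add_norm_sq_two_one (g : U21) : ‖mat g 2 0‖ ^ 2 + ‖mat g 2 1‖ ^ 2 = ‖mat g 2 2‖ ^ 2 - 1 := by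
  have h := row_identity g 2
  simp only [if_true] at h
  linarith

end Entry

/-! ## §2 The inequality -/

section Inequality

/-- **NON-NEGATIVE WEIGHTS IN A COMMON HALF-PLANE**: for `a, b ∈ ℂ` with `Re(a·b̄) ≥ 0` and `x, y ≥ 0`, `min(|a|,|b|)·(x + y) ≤ √2·|a·x + b·y|`
(`|ax+by|² = |a|²x² + |b|²y² + 2xy·Re(ab̄) ≥ min² (x²+y²) ≥ min²(x+y)²∕2`). [cite: Rudin1980, §1.4] -/
theorem min_norm_mul_add_le_sqrt_two_mul_norm {a b : ℂ} (hab : 0 ≤ (a * conj b).re) {x y : ℝ} (hx : 0 ≤ x) (hy : 0 ≤ y) :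
    min ‖a‖ ‖b‖ * (x + y) ≤ Real.sqrt 2 * ‖a * x + b * y‖ := by
  set m : ℝ := min ‖a‖ ‖b‖ with hm
  have hm0 : 0 ≤ m := le_min (norm_nonneg _) (norm_nonneg _)
  have hma : m ≤ ‖a‖ := min_le_left _ _
  have hmb : m ≤ ‖b‖ := min_le_right _ _
  -- `‖ax + by‖² = ‖a‖²x² + ‖b‖²y² + 2xy Re(a b̄)`
  have hsq : ‖a * x + b * y‖ ^ 2 = ‖a‖ ^ 2 * x ^ 2 + ‖b‖ ^ 2 * y ^ 2 + 2 * x * y * (a * conj b).re := by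
    rw [Complex.sq_norm, Complex.sq_norm, Complex.sq_norm, Complex.normSq_apply, Complex.normSq_apply, Complex.normSq_apply]
    simp only [Complex.add_re, Complex.add_im, Complex.mul_re, Complex.mul_im, Complex.ofReal_re, Complex.ofReal_im, Complex.conj_re, Complex.conj_im]
    ring
  have hlow : m ^ 2 * (x + y) ^ 2 ≤ 2 * ‖a * x + b * y‖ ^ 2 := by
    rw [hsq]
    have h1 : m ^ 2 * x ^ 2 ≤ ‖a‖ ^ 2 * x ^ 2 := mul_le_mul_of_nonneg_right (pow_le_pow_left₀ hm0 hma 2) (sq_nonneg x)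
    have h2 : m ^ 2 * y ^ 2 ≤ ‖b‖ ^ 2 * y ^ 2 := mul_le_mul_of_nonneg_right (pow_le_pow_left₀ hm0 hmb 2) (sq_nonneg y)
    have h3 : 0 ≤ 2 * x * y * (a * conj b).re := by positivity
    nlinarith [sq_nonneg (x - y), h1, h2, h3]
  -- take square roots
  have hL : 0 ≤ m * (x + y) := mul_nonneg hm0 (by linarith)
  have hR : 0 ≤ Real.sqrt 2 * ‖a * x + b * y‖ := mul_nonneg (Real.sqrt_nonneg _) (norm_nonneg _)
  have hsq2 : (Real.sqrt 2 * ‖a * x + b * y‖) ^ 2 = 2 * ‖a * x + b * y‖ ^ 2 := by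
    rw [mul_pow, Real.sq_sqrt (by norm_num : (0 : ℝ) ≤ 2)]
  have : (m * (x + y)) ^ 2 ≤ (Real.sqrt 2 * ‖a * x + b * y‖) ^ 2 := by rw [mul_pow, hsq2]; exact hlow
  exact (pow_le_pow_iff_left₀ hL hR two_ne_zero).1 this

/-- **THE ONE-LEVEL SUPPORT BOUND (D regime)**: for `g ∈ U(2,1)`, `t = diag(z₀,z₁,z₂)` with `Re((z₂−z₀)·conj(z₂−z₁)) ≥ 0`,
`(|g₂₂|² − 1)·min(|z₂−z₀|, |z₂−z₁|) ≤ √2·|(g·t·g⁻¹)₂₂ − z₂|` — the corner entry ALONE controls how far `g • x₀` is from the centre of the ball, uniformly over the fibre.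
[cite: Rogawski1990, §8.4 pp. 126–127] [cite: Goldman1999, §3.1.1] -/
theorem norm_22_sq_sub_one_mul_min_le (g : U21) (z : Fin 3 → Circle)
    (hz : (Matrix.diagonal fun i => (z i : ℂ))ᴴ * J * Matrix.diagonal (fun i => (z i : ℂ)) = J)
    (hD : 0 ≤ ((((z 2 : ℂ) - z 0)) * conj (((z 2 : ℂ) - z 1))).re) :
    (‖mat g 2 2‖ ^ 2 - 1) * min ‖(z 2 : ℂ) - z 0‖ ‖(z 2 : ℂ) - z 1‖ ≤
      Real.sqrt 2 * ‖mat (g * mkU21 (Matrix.diagonal fun i => (z i : ℂ)) hz * g⁻¹) 2 2 - z 2‖ := by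
  have h := min_norm_mul_add_le_sqrt_two_mul_norm hD (sq_nonneg ‖mat g 2 0‖) (sq_nonneg ‖mat g 2 1‖)
  rw [norm_sq_two_zero_add_norm_sq_two_one] at h
  rw [mat_conj_diagonal_apply_two_two_eq, mul_comm]
  convert h using 2
  push_cast
  ring_nf

end Inequality

/-! ## §3 Consequences: `|g₂₂|` and the base point `g • x₀` are confined -/

section Confinement

/-- **`|g₂₂|² ≤ 1 + √2R∕m`**: if `|(g·t·g⁻¹)₂₂ − z₂| ≤ R` and `0 < m ≤ min(|z₂−z₀|,|z₂−z₁|)` in the D regime, then `|g₂₂|² ≤ 1 + √2·R∕m`. [cite: Rogawski1990, §8.4 pp. 126–127] [cite: Goldman1999, §3.1.1] -/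
theorem norm_22_sq_le_of_corner_le (g : U21) (z : Fin 3 → Circle)
    (hz : (Matrix.diagonal fun i => (z i : ℂ))ᴴ * J * Matrix.diagonal (fun i => (z i : ℂ)) = J)
    (hD : 0 ≤ ((((z 2 : ℂ) - z 0)) * conj (((z 2 : ℂ) - z 1))).re) {m R : ℝ} (hm : 0 < m)
    (hmle : m ≤ min ‖(z 2 : ℂ) - z 0‖ ‖(z 2 : ℂ) - z 1‖) (hR : ‖mat (g * mkU21 (Matrix.diagonal fun i => (z i : ℂ)) hz * g⁻¹) 2 2 - z 2‖ ≤ R) :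
    ‖mat g 2 2‖ ^ 2 ≤ 1 + Real.sqrt 2 * R / m := by
  have h := norm_22_sq_sub_one_mul_min_le g z hz hD
  have hpos : 0 ≤ ‖mat g 2 2‖ ^ 2 - 1 := by nlinarith [one_le_norm_22 g, norm_nonneg (mat g 2 2)]
  have h1 : (‖mat g 2 2‖ ^ 2 - 1) * m ≤ Real.sqrt 2 * R :=
    le_trans (mul_le_mul_of_nonneg_left hmle hpos) (le_trans h (mul_le_mul_of_nonneg_left hR (Real.sqrt_nonneg _)))
  have h2 : ‖mat g 2 2‖ ^ 2 - 1 ≤ Real.sqrt 2 * R / m := (le_div_iff₀ hm).2 h1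
  linarith

/-- **THE BASE POINT STAYS IN A SUB-BALL**: under the same hypotheses `1 − |g•x₀|² ≥ (1 + √2R∕m)⁻¹` (★ `one_sub_nsq_smul_x₀`: `1 − |g•x₀|² = |g₂₂|⁻²`) — the one-level support bound in ball
coordinates, uniform over the `ℙ¹` fibre. [cite: Rudin1980, Thm 2.2.2] [cite: Rogawski1990, §8.4 pp. 126–127] -/
theorem one_div_le_one_sub_nsq_smul_x₀_of_corner_le (g : U21) (z : Fin 3 → Circle)
    (hz : (Matrix.diagonal fun i => (z i : ℂ))ᴴ * J * Matrix.diagonal (fun i => (z i : ℂ)) = J)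
    (hD : 0 ≤ ((((z 2 : ℂ) - z 0)) * conj (((z 2 : ℂ) - z 1))).re) {m R : ℝ} (hm : 0 < m)
    (hmle : m ≤ min ‖(z 2 : ℂ) - z 0‖ ‖(z 2 : ℂ) - z 1‖) (hR : ‖mat (g * mkU21 (Matrix.diagonal fun i => (z i : ℂ)) hz * g⁻¹) 2 2 - z 2‖ ≤ R) :
    1 / (1 + Real.sqrt 2 * R / m) ≤ 1 - nsq (g • x₀).1 := by
  have hsq := norm_22_sq_le_of_corner_le g z hz hD hm hmle hR
  have hpos : 0 < ‖mat g 2 2‖ ^ 2 := pow_pos (norm_22_pos g) 2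
  rw [one_sub_nsq_smul_x₀]
  exact one_div_le_one_div_of_le hpos hsq

end Confinement

/-! ## §4 The D regime on the torus: `Re((z₂−z₀)conj(z₂−z₁)) ≥ 0` iff `θ₂` is extremal (near the centre) -/

section Regime

/-- **THE HALF-PLANE CONDITION IN ANGLES**: for `z_p = ζ·e^{iθ_p}`,
`Re((z₂−z₀)·conj(z₂−z₁)) = (1 − cos(θ₂−θ₁))·(1 − cos(θ₀−θ₂)) − sin(θ₂−θ₁)·sin(θ₀−θ₂)` (`ζ` drops out). [cite: Rogawski1990, §8.4 pp. 126–127] -/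
theorem re_sub_mul_conj_sub_angles (ζ : Circle) (θ : Fin 3 → ℝ) :
    ((((ζ * Circle.exp (θ 2) : Circle) : ℂ) - ((ζ * Circle.exp (θ 0) : Circle) : ℂ)) * conj ((((ζ * Circle.exp (θ 2) : Circle) : ℂ) - ((ζ * Circle.exp (θ 1) : Circle) : ℂ)))).re =
      (1 - Real.cos (θ 2 - θ 1)) * (1 - Real.cos (θ 0 - θ 2)) - Real.sin (θ 2 - θ 1) * Real.sin (θ 0 - θ 2) := by
  have hζ : (ζ : ℂ) * conj (ζ : ℂ) = 1 := by
    rw [mul_comm, ← Complex.normSq_eq_conj_mul_self, Circle.normSq_coe, Complex.ofReal_one]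
  have he : ∀ a b : ℝ, Complex.exp (a * Complex.I) * conj (Complex.exp (b * Complex.I)) = Complex.exp (((a - b : ℝ) : ℂ) * Complex.I) := by
    intro a b
    rw [← Complex.exp_conj, map_mul, Complex.conj_ofReal, Complex.conj_I, ← Complex.exp_add]
    push_cast
    ring_nf
  have hid : ((((ζ * Circle.exp (θ 2) : Circle) : ℂ) - ((ζ * Circle.exp (θ 0) : Circle) : ℂ)) * conj ((((ζ * Circle.exp (θ 2) : Circle) : ℂ) - ((ζ * Circle.exp (θ 1) : Circle) : ℂ)))) =
      1 - Complex.exp (((θ 2 - θ 1 : ℝ) : ℂ) * Complex.I) - Complex.exp (((θ 0 - θ 2 : ℝ) : ℂ) * Complex.I) + Complex.exp (((θ 0 - θ 1 : ℝ) : ℂ) * Complex.I) := by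
    simp only [Circle.coe_mul, Circle.coe_exp, map_sub, map_mul]
    have hring : ((ζ : ℂ) * Complex.exp (θ 2 * Complex.I) - (ζ : ℂ) * Complex.exp (θ 0 * Complex.I)) *
        (conj (ζ : ℂ) * conj (Complex.exp (θ 2 * Complex.I)) - conj (ζ : ℂ) * conj (Complex.exp (θ 1 * Complex.I))) =
        ((ζ : ℂ) * conj (ζ : ℂ)) * (Complex.exp (θ 2 * Complex.I) * conj (Complex.exp (θ 2 * Complex.I)) - Complex.exp (θ 2 * Complex.I) * conj (Complex.exp (θ 1 * Complex.I))
          - Complex.exp (θ 0 * Complex.I) * conj (Complex.exp (θ 2 * Complex.I)) + Complex.exp (θ 0 * Complex.I) * conj (Complex.exp (θ 1 * Complex.I))) := by ring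
    rw [hring, hζ, one_mul, he, he, he, he, sub_self]
    push_cast
    rw [zero_mul, Complex.exp_zero]
  rw [hid]
  simp only [Complex.sub_re, Complex.add_re, Complex.one_re, Complex.exp_ofReal_mul_I_re]
  rw [show θ 0 - θ 1 = (θ 0 - θ 2) + (θ 2 - θ 1) by ring, Real.cos_add]
  ring

/-- **THE D REGIME**: if `θ₂` is extremal in the weak sense `(θ₂−θ₁)·(θ₀−θ₂) ≤ 0` and `|θ₂−θ₁|, |θ₀−θ₂| ≤ π`, then `Re((z₂−z₀)conj(z₂−z₁)) ≥ 0` for `z_p = ζe^{iθ_p}` (so §2–§3 apply): the four chambers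
adjacent to the compact wall, walls included. [cite: Rogawski1990, §8.4 pp. 126–127] -/
theorem re_sub_mul_conj_sub_nonneg_of_extremal (ζ : Circle) (θ : Fin 3 → ℝ) (hD : (θ 2 - θ 1) * (θ 0 - θ 2) ≤ 0)
    (h1 : |θ 2 - θ 1| ≤ Real.pi) (h2 : |θ 0 - θ 2| ≤ Real.pi) :
    0 ≤ ((((ζ * Circle.exp (θ 2) : Circle) : ℂ) - ((ζ * Circle.exp (θ 0) : Circle) : ℂ)) * conj ((((ζ * Circle.exp (θ 2) : Circle) : ℂ) - ((ζ * Circle.exp (θ 1) : Circle) : ℂ)))).re := by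
  rw [re_sub_mul_conj_sub_angles]
  have hc1 : 0 ≤ 1 - Real.cos (θ 2 - θ 1) := by linarith [Real.cos_le_one (θ 2 - θ 1)]
  have hc2 : 0 ≤ 1 - Real.cos (θ 0 - θ 2) := by linarith [Real.cos_le_one (θ 0 - θ 2)]
  -- `sin u · sin v ≤ 0` when `u·v ≤ 0` and `|u|,|v| ≤ π` (sine has the sign of its argument on `[−π, π]`)
  have hsin : Real.sin (θ 2 - θ 1) * Real.sin (θ 0 - θ 2) ≤ 0 := by
    set u := θ 2 - θ 1 with hu
    set v := θ 0 - θ 2 with hv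
    have key : ∀ s : ℝ, |s| ≤ Real.pi → 0 ≤ s * Real.sin s := by
      intro s hs
      rcases le_or_gt 0 s with h | h
      · exact mul_nonneg h (Real.sin_nonneg_of_nonneg_of_le_pi h (by rwa [abs_of_nonneg h] at hs))
      · have hs' : -s ≤ Real.pi := by rwa [abs_of_neg h] at hs
        have : Real.sin s ≤ 0 := by
          have := Real.sin_nonneg_of_nonneg_of_le_pi (by linarith : 0 ≤ -s) hs'
          rw [Real.sin_neg] at this; linarith
        exact mul_nonneg_of_nonpos_of_nonpos h.le this
    have hu' := key u h1
    have hv' := key v h2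
    -- `(u sin u)(v sin v) ≥ 0` and `uv ≤ 0` ⇒ `sin u sin v ≤ 0` unless `u = 0` or `v = 0` (then a sine vanishes)
    by_cases hu0 : u = 0
    · simp [hu0]
    by_cases hv0 : v = 0
    · simp [hv0]
    have huv : u * v < 0 := lt_of_le_of_ne hD (mul_ne_zero hu0 hv0)
    have hprod : 0 ≤ (u * v) * (Real.sin u * Real.sin v) := by
      have := mul_nonneg hu' hv'
      nlinarith [this]
    nlinarith [hprod, huv]
  nlinarith [mul_nonneg hc1 hc2, hsin]

end Regime

end BallModel

end Literature.Geometry.ComplexHyperbolic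

end
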